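import Mathlib.Data.Matrix.Block
import Mathlib.LinearAlgebra.Matrix.Notation
import Mathlib.Data.ZMod.Defs
import Mathlib.Tactic.FinCases
import Mathlib.Tactic.NoncommRing
import HarnessLib

/-!
# Golyshev–Lunts–Orlov, Lemma 9.4.5 (dual tori from an `I`-stable isotropic decomposition) and the lattice
# bookkeeping of Prop. 9.6.1 (the mirror `E₁ × ⋯ × E_n` of a weak pair `(A, τφ)`) in block form

Venture cell `pub-hsemireg`, literature seat `lit-w-polishchuk-orlov` (g14, 2026-08-25). Companion of
`GolyshevLuntsOrlovIomega.lean` (display (14), Lemma 9.4.1) — not imported; every statement below is about explicit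
block matrices `Matrix.fromBlocks` over a commutative ring, in the same model.

PRINTED ([GolyshevLuntsOrlov2001MirrorAV] = V. Golyshev, V. Lunts, D. Orlov, «Mirror symmetry for abelian varieties»,
J. Algebraic Geom. 10 (2001) 433–496; quoted from the authors' arXiv text math/9812003v2, text layer of the cell copy
`widen/LIT-W/texts-po/glo01v2/`, pages as numbered there):
* §1.2 (p. 5 L48–56): «One has the dual torus `Â` defined as follows. Put `Γ* = Hom_ℤ(Γ, ℤ)`, `V* = Γ* ⊗ ℝ = Hom(V, ℝ)`
  and `Ĵ : V* → V*`, s.t. `(Ĵw)(v) = w(−Jv)` for `v ∈ V`, `w ∈ V*`. Then by definition `Â = (V*/Γ*, Ĵ)`.»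
* §3.1 (p. 7): `Λ = Γ ⊕ Γ*` with «the canonical symmetric bilinear form `Q((a₁, b₁), (a₂, b₂)) = b₁(a₂) + b₂(a₁)`».
* DEF. 9.2 (p. 25 L80–96): pairs `(A, ω_A)`, `(B, ω_B)` «are mirror symmetric if there is an isomorphism
  `α : Γ_A ⊕ Γ_Â ⥲ Γ_B ⊕ Γ_B̂` which identifies bilinear forms `Q_A` and `Q_B` and satisfies …
  `α_ℝ · J_{A×Â} = I_{ω_B} · α_ℝ`, `α_ℝ · I_{ω_A} = J_{B×B̂} · α_ℝ`.»
* LEMMA 9.4.5 (p. 28 L140 – p. 29 L19): «Let `Λ = Γ ⊕ Γ*` be a lattice with canonical symmetric bilinear form `Q` (3.1).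
  Let there be given an isotropic decomposition `Λ = Λ₁ ⊕ Λ₂`. Suppose `I ∈ GL(Λ_ℝ)` is a complex structure on `Λ_ℝ`,
  i.e. `I² = −1`, that satisfies the following assumptions a) `I(Λ_{i,ℝ}) = Λ_{i,ℝ}`, `i = 1, 2` b) `I ∈ O(Λ_ℝ, Q_ℝ)`.
  Then the complex tori `B₁ := (Λ_{1,ℝ}/Λ₁, I₁)`, `B₂ := (Λ_{2,ℝ}/Λ₂, I₂)`, where `I_i` are the restriction of `I` on
  `Λ_{i,ℝ}`, are dual to each other, i.e. `B₂ ≅ B̂₁`. Proof. The form `Q` induces the isomorphism `t : Λ₂ → Λ₁*` that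
  takes `λ₂ ∈ Λ₂` to linear functional `Q(λ₂, ·)`. It remains to show that for any `v₁ ∈ Λ_{1,ℝ}`, `v₂ ∈ Λ_{2,ℝ}` the
  following equality holds `t(I₂(v₂))(v₁) = t(v₂)(−I₁(v₁))` (3.1). This is straightforward using the inclusion
  `J ∈ O(Λ_ℝ, Q_ℝ)`. `t(I₂(v₂))(v₁) = Q_ℝ(I₂(v₂), v₁) = Q_ℝ(I₂²(v₂), I₁(v₁)) = Q_ℝ(−v₂, I₁(v₁)) = t(v₂)(−I₁(v₁))`.»
* 9.4.6 SUMMARY (p. 29 L20–43): «put `Λ = Γ_A ⊕ Γ_Â`. It suffices to find a `Q_A`–isotropic decomposition `Λ = Λ₁ ⊕ Λ₂`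
  such that `Λ_{1ℝ}`, `Λ_{2ℝ}` are preserved by `I_{ω_A}`. Then by Lemma 9.4.5 the tori `B := (Λ_{1ℝ}/Λ₁, I_{ω_A})` and
  `B̂ := (Λ_{2ℝ}/Λ₂, I_{ω_A})` are dual.»
* PROP. 9.6.1 (p. 29 L89–100): «Let `A` be a complex torus of dimension `n`. Let `φ ∈ NS_A⁰`, i.e. `φ ∈ Hom(A, Â)`
  is an isogeny. Let `τ = a + ib ∈ ℂ`, `b ≠ 0`. Consider the element `ω_A := τφ ∈ NS_A(ℂ)⁰` and the weak pair
  `(A, ω_A)`. Then there exist isogeneous elliptic curves `E₁, ..., E_n` and an element `ω_E ∈ NS_E(ℂ)⁰`, where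
  `E = E₁ × ... × E_n`, such that the weak pair `(E, ω_E)` is mirror symmetric to the weak pair `(A, ω_A)`.» Its proof
  (p. 29 L101 – p. 30 L19): «There exists a basis `e₁, ..., e_n, e₋₁, ..., e₋ₙ` of `Γ_A` in which the bilinear form
  `φ` has a matrix `(0 Δ; −Δ 0)`, where `Δ =` [the displayed diagonal matrix with entries `δ₁, …, δ_n`], `δ_i ∈ ℤ`,
  `δ₁|δ₂|δ₃...` Let `e*₁, ... e*ₙ, e*₋₁, ..., e*₋ₙ` be the dual basis of `Γ_Â`. Then the map `φ : Γ_A → Γ_Â` is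
  `φ : e_i ↦ δ_i e*₋ᵢ`, `e₋ᵢ ↦ −δ_i e*ᵢ`. Put `Γ_i := ℤe_i ⊕ ℤe*₋ᵢ`, `Γ*_i := ℤe₋ᵢ ⊕ ℤe*ᵢ`, `i = 1, ..., n`. Clearly
  the subgroups `Λ₁ := ⊕Γ_i`, `Λ₂ := ⊕Γ*_i` are isotropic. We have `I_{ω_A} = (b⁻¹a −b⁻¹φ⁻¹; (b + ab⁻¹a)φ −ab⁻¹)`.
  This operator preserves each subspace `Γ_{iℝ}`, `Γ*_{iℝ}`. In particular it preserves `Λ_{1,ℝ}`, `Λ_{2,ℝ}`. Thus by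
  Lemma 9.4.5 the tori `(Λ_{1,ℝ}/Λ₁, I_{ω_A})`, `(Λ_{2,ℝ}/Λ₂, I_{ω_A})` are dual. Moreover, it is clear that the torus
  `(Λ_{1,ℝ}/Λ₁, I_{ω_A})` is a product of elliptic curves `E_i := (Γ_{iℝ}/Γ_i, I_ω)`, `i = 1, ..., n`. For each `i` the
  map `Γ₁ → Γ_i`, `e₁ ↦ e_i`, `e*₋₁ ↦ δ₁⁻¹δ_i e*₋ᵢ` commutes with `I_{ω_A}` and so is an isogeny of elliptic curves
  `E₁` and `E_i`.»

MODEL (ASSUMED; Rem. 1.6's dictionary, as in the companion files): bases are fixed and dual; an element of `End(Λ_ℝ)`,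
`Λ = Γ_A ⊕ Γ_Â`, is `fromBlocks a b c d` over a commutative ring `R` (read `ℝ`) with `c : V_A → V_Â` the LOWER-LEFT
block; `Q = (0 1; 1 0)`; inverses are carried as second matrices (`Δ Δ' = 1 = Δ' Δ`, `b b' = 1`). For Prop. 9.6.1 the
basis of `Γ_A` is indexed by `n ⊕ n` (`inl i = e_i`, `inr i = e₋ᵢ`), that of `Γ_Â` by `n ⊕ n` (`inl i = e*ᵢ`,
`inr i = e*₋ᵢ`); the MAP `φ : V_A → V_Â`, `e_i ↦ δ_i e*₋ᵢ`, `e₋ᵢ ↦ −δ_i e*ᵢ`, is the block matrix `(0 −Δ; Δ 0)` (the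
printed `(0 Δ; −Δ 0)` is the matrix of the bilinear FORM, its transpose; `Δᵀ = Δ`), `φ⁻¹ = (0 Δ'; −Δ' 0)`; `I_{ω_A}` is
the right-hand side of `GolyshevLuntsOrlovIomega.iomega_scalar`, written with `p := ab⁻¹ = b⁻¹a`, `c := b + ab⁻¹a`:
`I = (p·1 −b'φ⁻¹; cφ −p·1)`. The change to the bases `(e_i, e*₋ᵢ)` of `Λ₁ = ⊕Γ_i` and `(e*ᵢ, e₋ᵢ)` of `Λ₂ = ⊕Γ*_i`
(this ORDER makes the second basis `Q`-dual to the first) is the permutation matrix `S` below (`Sᵀ = S`, `S² = 1`).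

## Results (PROVED; theorems only — no definition, no named fact, no `sorry`; imports Mathlib + HarnessLib)
* `dual_of_stable_isotropic` (LEMMA 9.4.5 in the model): in `Q`-dual bases of an isotropic decomposition
  (`Q = (0 1; 1 0)`), if `I = diag(I₁, I₂)` (assumption a)) satisfies `Iᵀ Q I = Q` (assumption b)) and `I² = −1`, then
  **`I₂ = −I₁ᵀ`** — i.e. `I₂ = Î₁` (§1.2: `(Ĵw)(v) = w(−Jv)`); `pairing_dual`: the printed identity
  `Q(I₂v₂, v₁) = Q(v₂, −I₁v₁)` for all coordinate vectors; converse `dualPair_sq` ∕ `dualPair_orthogonal`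
  (`diag(J, −Jᵀ)` is a `Q`-orthogonal complex structure whenever `J² = −1`). PROVED HERE (as printed: `I₁ᵀI₂ = 1` from
  b), `I₂² = −1` from `I² = −1`).
* Prop. 9.6.1's bookkeeping, for ALL square `Δ, Δ'` and scalars `p, b', c` unless said otherwise:
  `basisChange_mul_self` (`S S = 1`), `basisChange_transpose` (`Sᵀ = S`), **`basisChange_Q`** (`Sᵀ Q S = Q`: «the
  subgroups `Λ₁`, `Λ₂` are isotropic» and `Q`-dual), **`basisChange_iomega`** (`Sᵀ I S = diag(X₁, X₂)` with
  `X₁ = (p·1 −b'Δ'; cΔ −p·1)` on `Λ₁` and `X₂ = (−p·1 −cΔ; b'Δ' p·1)` on `Λ₂`: «preserves `Λ_{1,ℝ}`, `Λ_{2,ℝ}`»),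
  **`restr2_eq_dual_restr1`** (`Δᵀ = Δ`, `Δ'ᵀ = Δ' ⟹ X₂ = −X₁ᵀ`: «the tori … are dual», here read off directly);
  `restr1_sq` (`b'c − p² = 1`, `Δ Δ' = 1 = Δ' Δ ⟹ X₁² = −1`), `scalars_key` (`b b' = 1 ⟹ b'c − p² = 1` for the
  printed `p = ab'`, `c = b + ab'a`) and `restr_dualPair` (then `diag(X₁, −X₁ᵀ)` is `Q`-orthogonal with square `−1`:
  Lemma 9.4.5's assumptions a), b) hold on the nose and `dual_of_stable_isotropic` returns the same `X₂ = −X₁ᵀ`).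
* `restr1_entry_offDiag` ∕ `restr1_submatrix` (`Δ = diag δ`, `Δ' = diag δ'`): `X₁` has no entry between `Γ_i` and `Γ_j`,
  `i ≠ j`, and its `Γ_i`-block is `(p −b'δ'ᵢ; cδᵢ −p)` («a product of elliptic curves `E_i`»); `isogeny_commutes`:
  `δᵢ = dδ₁`, `δ₁δ'₁ = 1 = δᵢδ'ᵢ ⟹ diag(1, d)·(p −b'δ'₁; cδ₁ −p) = (p −b'δ'ᵢ; cδᵢ −p)·diag(1, d)` («the map `Γ₁ → Γ_i`,
  `e₁ ↦ e_i`, `e*₋₁ ↦ δ₁⁻¹δ_i e*₋ᵢ` commutes with `I_{ω_A}`»).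
* Non-vacuity: `example_integral` (`ℤ`, `n = Fin 1`, `Δ = 1`, `τ = 1 + i`) and `example_mod5` (`ZMod 5`, `n = Fin 2`,
  `δ = (1, 2)`, `δ' = (1, 3)`, `d = 2`), by `decide`.

NOT typed here: the existence half of §9.6 (criterion (∗) `J_{A×Â}W ∩ W = 0` and Lemma 9.6.2's induction), Lemma 9.4.4
and Prop. 9.4.3 (they quantify over `C_A`, `Hdg`, `U_{A,ℚ}`). HONEST FRAMING: identities between block matrices over a
commutative ring; the dictionary (dual bases, `φ ↦ (0 −Δ; Δ 0)`, `I_{ω_A}` from display (14)) is the print's own and is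
ASSUMED; nothing here constructs a torus, an elliptic curve, a mirror pair or an isogeny, and nothing says HC ∕ HC_CM ∕
HC_AV holds.
-/

namespace Summit.Ventures.HSemireg.GolyshevLuntsOrlovMirror

open Matrix

variable {R : Type*} [CommRing R] {m n : Type*} [Fintype m] [DecidableEq m] [Fintype n] [DecidableEq n]

omit [Fintype m] in
/-- `(−1) ⊕ (−1) = −1`. -/
private theorem fromBlocks_neg_one_eq :
    fromBlocks (-1) 0 0 (-1) = (-1 : Matrix (m ⊕ m) (m ⊕ m) R) := by
  rw [← fromBlocks_one, fromBlocks_neg, neg_zero]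

section Lemma945

/-- **LEMMA 9.4.5** in the model: `Q`-dual bases of an isotropic decomposition `Λ = Λ₁ ⊕ Λ₂` (`Q = (0 1; 1 0)`),
`I = diag(I₁, I₂)` (assumption a)), `Iᵀ Q I = Q` (assumption b)) and `I² = −1` give **`I₂ = −I₁ᵀ`**, i.e. `I₂ = Î₁`
in the sense of §1.2 — «`B₂ ≅ B̂₁`» [cite: GolyshevLuntsOrlov2001MirrorAV, Lemma 9.4.5 + proof (arXiv v2 p. 28 L140 –
p. 29 L19); §1.2 (p. 5)]. PROVED HERE along the printed lines (`Q(I₂v₂, v₁) = Q(I₂²v₂, I₁v₁) = Q(−v₂, I₁v₁)`). -/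
theorem dual_of_stable_isotropic {I₁ I₂ : Matrix m m R}
    (hQ : (fromBlocks I₁ 0 0 I₂)ᵀ * fromBlocks 0 1 1 0 * fromBlocks I₁ 0 0 I₂ = fromBlocks 0 1 1 0)
    (hsq : fromBlocks I₁ 0 0 I₂ * fromBlocks I₁ 0 0 I₂ = -1) : I₂ = -I₁ᵀ := by
  have h1 : I₁ᵀ * I₂ = 1 := by
    simp only [fromBlocks_transpose, transpose_zero, fromBlocks_multiply, Matrix.mul_zero, Matrix.zero_mul,
      Matrix.mul_one, add_zero, zero_add] at hQ
    exact (fromBlocks_inj.mp hQ).2.1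
  have h2 : I₂ * I₂ = -1 := by
    rw [← fromBlocks_neg_one_eq, fromBlocks_multiply] at hsq
    simpa only [Matrix.mul_zero, Matrix.zero_mul, add_zero, zero_add] using (fromBlocks_inj.mp hsq).2.2.2
  calc I₂ = I₁ᵀ * I₂ * I₂ := by rw [h1, Matrix.one_mul]
    _ = -I₁ᵀ := by rw [Matrix.mul_assoc, h2, Matrix.mul_neg, Matrix.mul_one]

/-- The printed identity of Lemma 9.4.5's proof, `t(I₂(v₂))(v₁) = t(v₂)(−I₁(v₁))` with
`t(v₂)(v₁) = Q((0, v₂), (v₁, 0)) = v₂ · v₁`: for all coordinate vectors, `(I₂ v₂) · v₁ = v₂ · (−I₁ v₁)`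
[cite: GolyshevLuntsOrlov2001MirrorAV, Lemma 9.4.5, proof (arXiv v2 p. 29 L11–L17)]. PROVED HERE. -/
theorem pairing_dual {I₁ I₂ : Matrix m m R}
    (hQ : (fromBlocks I₁ 0 0 I₂)ᵀ * fromBlocks 0 1 1 0 * fromBlocks I₁ 0 0 I₂ = fromBlocks 0 1 1 0)
    (hsq : fromBlocks I₁ 0 0 I₂ * fromBlocks I₁ 0 0 I₂ = -1) (v₁ v₂ : m → R) :
    (I₂ *ᵥ v₂) ⬝ᵥ v₁ = v₂ ⬝ᵥ (-(I₁ *ᵥ v₁)) := by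
  rw [dual_of_stable_isotropic hQ hsq, neg_mulVec, neg_dotProduct, dotProduct_neg, mulVec_transpose,
    dotProduct_mulVec]

/-- Converse direction: for `J² = −1`, `diag(J, −Jᵀ)` squares to `−1` … -/
theorem dualPair_sq {J : Matrix m m R} (hJ : J * J = -1) :
    fromBlocks J 0 0 (-Jᵀ) * fromBlocks J 0 0 (-Jᵀ) = -1 := by
  have hJt : Jᵀ * Jᵀ = -1 := by rw [← transpose_mul, hJ, transpose_neg, transpose_one]
  simp only [fromBlocks_multiply, Matrix.mul_zero, Matrix.zero_mul, add_zero, zero_add, Matrix.neg_mul,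
    Matrix.mul_neg, neg_neg, hJ, hJt, neg_zero, fromBlocks_neg_one_eq]

/-- … and is `Q`-orthogonal: the dual pair `(B, B̂)` meets assumptions a), b) of Lemma 9.4.5
[cite: GolyshevLuntsOrlov2001MirrorAV, §1.2 with Prop. 5.2, proof of 1) (arXiv v2 pp. 5, 20)]. DERIVED HERE. -/
theorem dualPair_orthogonal {J : Matrix m m R} (hJ : J * J = -1) :
    (fromBlocks J 0 0 (-Jᵀ))ᵀ * fromBlocks 0 1 1 0 * fromBlocks J 0 0 (-Jᵀ) = fromBlocks 0 1 1 0 := by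
  have hJt : Jᵀ * Jᵀ = -1 := by rw [← transpose_mul, hJ, transpose_neg, transpose_one]
  simp only [fromBlocks_transpose, fromBlocks_multiply, transpose_zero, transpose_neg, transpose_transpose,
    Matrix.mul_zero, Matrix.zero_mul, add_zero, zero_add, Matrix.mul_one, Matrix.neg_mul, Matrix.mul_neg, hJ,
    hJt, neg_neg, neg_zero]

end Lemma945

section Prop961

/-! ### Prop. 9.6.1: `Λ = Γ_A ⊕ Γ_Â` with `Γ_A`, `Γ_Â` indexed by `n ⊕ n`; `φ = (0 −Δ; Δ 0)`, `φ⁻¹ = (0 Δ'; −Δ' 0)`;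
`I = (p·1 −b'φ⁻¹; cφ −p·1)`; `S` = the change to the bases `(e_i, e*₋ᵢ)` of `Λ₁`, `(e*ᵢ, e₋ᵢ)` of `Λ₂`. -/

/-- `φ φ⁻¹ = 1` in the model: `(0 −Δ; Δ 0)(0 Δ'; −Δ' 0) = 1` for `Δ Δ' = 1`. -/
theorem phi_mul_phiInv {Δ Δ' : Matrix n n R} (h : Δ * Δ' = 1) :
    fromBlocks 0 (-Δ) Δ 0 * fromBlocks 0 Δ' (-Δ') 0 = 1 := by
  simp only [fromBlocks_multiply, Matrix.mul_zero, Matrix.zero_mul, add_zero, zero_add, Matrix.neg_mul,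
    Matrix.mul_neg, neg_neg, h, neg_zero, fromBlocks_one]

/-- `φ⁻¹ φ = 1` for `Δ' Δ = 1`. -/
theorem phiInv_mul_phi {Δ Δ' : Matrix n n R} (h' : Δ' * Δ = 1) :
    fromBlocks 0 Δ' (-Δ') 0 * fromBlocks 0 (-Δ) Δ 0 = 1 := by
  simp only [fromBlocks_multiply, Matrix.mul_zero, Matrix.zero_mul, add_zero, zero_add, Matrix.neg_mul,
    Matrix.mul_neg, neg_neg, h', neg_zero, fromBlocks_one]

omit [Fintype n] [DecidableEq n] in
/-- `φ` is antisymmetric (a Néron–Severi class, `φ̂ = φ`) iff `Δᵀ = Δ`; here the direction used: `Δᵀ = Δ ⟹ φᵀ = −φ`. -/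
theorem phi_transpose {Δ : Matrix n n R} (hΔ : Δᵀ = Δ) :
    (fromBlocks 0 (-Δ) Δ 0)ᵀ = -fromBlocks 0 (-Δ) Δ 0 := by
  simp only [fromBlocks_transpose, transpose_zero, transpose_neg, hΔ, fromBlocks_neg, neg_neg, neg_zero]

/-- `S² = 1` for the basis change `S = ((1 0; 0 0) (0 0; 0 1); (0 0; 0 1) (1 0; 0 0))` (a permutation of order 2:
it exchanges the `e₋` and `e*₋` coordinates). -/
theorem basisChange_mul_self :
    fromBlocks (fromBlocks 1 0 0 0) (fromBlocks 0 0 0 1) (fromBlocks 0 0 0 1) (fromBlocks 1 0 0 0) *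
      fromBlocks (fromBlocks 1 0 0 0) (fromBlocks 0 0 0 1) (fromBlocks 0 0 0 1) (fromBlocks 1 0 0 0) =
      (1 : Matrix ((n ⊕ n) ⊕ (n ⊕ n)) ((n ⊕ n) ⊕ (n ⊕ n)) R) := by
  simp only [fromBlocks_multiply, Matrix.mul_zero, Matrix.mul_one, add_zero, zero_add, fromBlocks_zero,
    fromBlocks_add, ← fromBlocks_one]

omit [Fintype n] in
/-- `Sᵀ = S`. -/
theorem basisChange_transpose :
    (fromBlocks (fromBlocks 1 0 0 0) (fromBlocks 0 0 0 1) (fromBlocks 0 0 0 1) (fromBlocks 1 0 0 0) :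
        Matrix ((n ⊕ n) ⊕ (n ⊕ n)) ((n ⊕ n) ⊕ (n ⊕ n)) R)ᵀ =
      fromBlocks (fromBlocks 1 0 0 0) (fromBlocks 0 0 0 1) (fromBlocks 0 0 0 1) (fromBlocks 1 0 0 0) := by
  simp only [fromBlocks_transpose, transpose_one, transpose_zero]

/-- **«Clearly the subgroups `Λ₁ := ⊕Γ_i`, `Λ₂ := ⊕Γ*_i` are isotropic»** — and `Q`-dual in the chosen order: in the
new bases the form is again the canonical one, `Sᵀ Q S = Q` [cite: GolyshevLuntsOrlov2001MirrorAV, proof of Prop.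
9.6.1 (arXiv v2 p. 29 L140–L143)]. PROVED HERE. -/
theorem basisChange_Q :
    (fromBlocks (fromBlocks 1 0 0 0) (fromBlocks 0 0 0 1) (fromBlocks 0 0 0 1) (fromBlocks 1 0 0 0) :
        Matrix ((n ⊕ n) ⊕ (n ⊕ n)) ((n ⊕ n) ⊕ (n ⊕ n)) R)ᵀ *
      fromBlocks 0 1 1 0 *
      fromBlocks (fromBlocks 1 0 0 0) (fromBlocks 0 0 0 1) (fromBlocks 0 0 0 1) (fromBlocks 1 0 0 0) =
      fromBlocks 0 1 1 0 := by
  simp only [fromBlocks_transpose, transpose_one, transpose_zero, fromBlocks_multiply, Matrix.mul_zero,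
    Matrix.mul_one, add_zero, zero_add, fromBlocks_add, ← fromBlocks_one, fromBlocks_zero]

/-- **«This operator preserves … `Λ_{1,ℝ}`, `Λ_{2,ℝ}`»**: in the new bases `I = (p·1 −b'φ⁻¹; cφ −p·1)` is block
DIAGONAL, `Sᵀ I S = diag(X₁, X₂)` with `X₁ = (p·1 −b'Δ'; cΔ −p·1)` (on `Λ₁`, basis `(e_i, e*₋ᵢ)`) and
`X₂ = (−p·1 −cΔ; b'Δ' p·1)` (on `Λ₂`, basis `(e*ᵢ, e₋ᵢ)`) — for all `Δ, Δ', p, b', c`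
[cite: GolyshevLuntsOrlov2001MirrorAV, proof of Prop. 9.6.1 (arXiv v2 p. 29 L144 – p. 30 L6)]. PROVED HERE. -/
theorem basisChange_iomega (Δ Δ' : Matrix n n R) (p b' c : R) :
    (fromBlocks (fromBlocks 1 0 0 0) (fromBlocks 0 0 0 1) (fromBlocks 0 0 0 1) (fromBlocks 1 0 0 0) :
        Matrix ((n ⊕ n) ⊕ (n ⊕ n)) ((n ⊕ n) ⊕ (n ⊕ n)) R)ᵀ *
      fromBlocks (p • (1 : Matrix (n ⊕ n) (n ⊕ n) R)) (-(b' • fromBlocks 0 Δ' (-Δ') 0))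
        (c • fromBlocks 0 (-Δ) Δ 0) (-(p • (1 : Matrix (n ⊕ n) (n ⊕ n) R))) *
      fromBlocks (fromBlocks 1 0 0 0) (fromBlocks 0 0 0 1) (fromBlocks 0 0 0 1) (fromBlocks 1 0 0 0) =
      fromBlocks (fromBlocks (p • (1 : Matrix n n R)) (-(b' • Δ')) (c • Δ) (-(p • 1))) 0 0
        (fromBlocks (-(p • (1 : Matrix n n R))) (-(c • Δ)) (b' • Δ') (p • 1)) := by
  simp only [fromBlocks_transpose, transpose_one, transpose_zero, ← fromBlocks_one, fromBlocks_smul,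
    fromBlocks_neg, smul_zero, neg_zero, fromBlocks_multiply, Matrix.mul_zero, Matrix.zero_mul, Matrix.mul_one,
    Matrix.one_mul, add_zero, zero_add, fromBlocks_add, Matrix.mul_smul, Matrix.mul_neg, neg_neg, smul_neg,
    fromBlocks_zero]

omit [Fintype n] in
/-- **«Thus by Lemma 9.4.5 the tori `(Λ_{1,ℝ}/Λ₁, I_{ω_A})`, `(Λ_{2,ℝ}/Λ₂, I_{ω_A})` are dual»** — read off directly:
for `Δᵀ = Δ`, `Δ'ᵀ = Δ'` (e.g. `Δ` diagonal) the two restrictions satisfy `X₂ = −X₁ᵀ`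
[cite: GolyshevLuntsOrlov2001MirrorAV, proof of Prop. 9.6.1 (arXiv v2 p. 30 L6–L8)]. PROVED HERE. -/
theorem restr2_eq_dual_restr1 {Δ Δ' : Matrix n n R} (hΔ : Δᵀ = Δ) (hΔ' : Δ'ᵀ = Δ') (p b' c : R) :
    fromBlocks (-(p • (1 : Matrix n n R))) (-(c • Δ)) (b' • Δ') (p • 1) =
      -(fromBlocks (p • (1 : Matrix n n R)) (-(b' • Δ')) (c • Δ) (-(p • 1)))ᵀ := by
  simp only [fromBlocks_transpose, transpose_smul, transpose_one, transpose_neg, hΔ, hΔ', fromBlocks_neg,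
    neg_neg]

/-- The restriction `X₁ = (p·1 −b'Δ'; cΔ −p·1)` is a complex structure: `b'c − p² = 1`, `Δ Δ' = 1 = Δ' Δ ⟹ X₁² = −1`
(for the printed scalars `p = ab⁻¹`, `c = b + a²b⁻¹` the identity `b'c − p² = 1` is `scalars_key`)
[cite: GolyshevLuntsOrlov2001MirrorAV, proof of Prop. 9.6.1 (arXiv v2 p. 30 L8–L10: `E_i := (Γ_{iℝ}/Γ_i, I_ω)`)].
DERIVED HERE. -/
theorem restr1_sq {Δ Δ' : Matrix n n R} (h : Δ * Δ' = 1) (h' : Δ' * Δ = 1) {p b' c : R}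
    (hk : b' * c - p * p = 1) :
    fromBlocks (p • (1 : Matrix n n R)) (-(b' • Δ')) (c • Δ) (-(p • 1)) *
      fromBlocks (p • (1 : Matrix n n R)) (-(b' • Δ')) (c • Δ) (-(p • 1)) = -1 := by
  have hk' : p * p - b' * c = -1 := by rw [← neg_sub, hk]
  have e1 : (p * p) • (1 : Matrix n n R) + -((b' * c) • 1) = -1 := by
    rw [← sub_eq_add_neg, ← sub_smul, hk', neg_smul, one_smul]
  have e2 : -((b' * c) • (1 : Matrix n n R)) + (p * p) • 1 = -1 := by rw [add_comm, e1]
  simp only [fromBlocks_multiply, Matrix.smul_mul, Matrix.mul_smul, Matrix.one_mul, Matrix.mul_one,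
    Matrix.neg_mul, Matrix.mul_neg, neg_neg, smul_smul, h, h', smul_neg, mul_comm p b', mul_comm c p,
    mul_comm c b', neg_add_cancel, add_neg_cancel, e1, e2, fromBlocks_neg_one_eq]

/-- The printed scalars: `τ = a + ib`, `b b' = 1`, `p := ab'` (`= b⁻¹a = ab⁻¹`), `c := b + ab'a` satisfy
`b'c − p² = b'b = 1`. -/
theorem scalars_key {a b b' : R} (hb : b * b' = 1) : b' * (b + a * b' * a) - a * b' * (a * b') = 1 := by
  have e : b' * (b + a * b' * a) - a * b' * (a * b') = b * b' := by ring
  rw [e, hb]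

/-- Hence Lemma 9.4.5's assumptions hold ON THE NOSE for `diag(X₁, X₂) = diag(X₁, −X₁ᵀ)`: it is `Q`-orthogonal and
squares to `−1` (`dualPair_orthogonal`, `dualPair_sq`), and `dual_of_stable_isotropic` returns `X₂ = −X₁ᵀ`
[cite: GolyshevLuntsOrlov2001MirrorAV, proof of Prop. 9.6.1 (arXiv v2 p. 30 L6–L8)]. DERIVED HERE. -/
theorem restr_dualPair {Δ Δ' : Matrix n n R} (h : Δ * Δ' = 1) (h' : Δ' * Δ = 1) {p b' c : R}
    (hk : b' * c - p * p = 1) :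
    (fromBlocks (fromBlocks (p • (1 : Matrix n n R)) (-(b' • Δ')) (c • Δ) (-(p • 1))) 0 0
        (-(fromBlocks (p • (1 : Matrix n n R)) (-(b' • Δ')) (c • Δ) (-(p • 1)))ᵀ))ᵀ * fromBlocks 0 1 1 0 *
      fromBlocks (fromBlocks (p • (1 : Matrix n n R)) (-(b' • Δ')) (c • Δ) (-(p • 1))) 0 0
        (-(fromBlocks (p • (1 : Matrix n n R)) (-(b' • Δ')) (c • Δ) (-(p • 1)))ᵀ) = fromBlocks 0 1 1 0 ∧
    fromBlocks (fromBlocks (p • (1 : Matrix n n R)) (-(b' • Δ')) (c • Δ) (-(p • 1))) 0 0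
        (-(fromBlocks (p • (1 : Matrix n n R)) (-(b' • Δ')) (c • Δ) (-(p • 1)))ᵀ) *
      fromBlocks (fromBlocks (p • (1 : Matrix n n R)) (-(b' • Δ')) (c • Δ) (-(p • 1))) 0 0
        (-(fromBlocks (p • (1 : Matrix n n R)) (-(b' • Δ')) (c • Δ) (-(p • 1)))ᵀ) = -1 :=
  ⟨dualPair_orthogonal (restr1_sq h h' hk), dualPair_sq (restr1_sq h h' hk)⟩

omit [Fintype n] in
/-- **«a product of elliptic curves `E_i := (Γ_{iℝ}/Γ_i, I_ω)`»**: for DIAGONAL `Δ = diag δ`, `Δ' = diag δ'` the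
restriction `X₁` has no matrix entry between `Γ_i = ⟨e_i, e*₋ᵢ⟩` and `Γ_j`, `i ≠ j`
[cite: GolyshevLuntsOrlov2001MirrorAV, proof of Prop. 9.6.1 (arXiv v2 p. 30 L3–L10)]. PROVED HERE. -/
theorem restr1_entry_offDiag (δ δ' : n → R) (p b' c : R) {i j : n} (hij : i ≠ j) :
    fromBlocks (p • (1 : Matrix n n R)) (-(b' • diagonal δ')) (c • diagonal δ) (-(p • 1)) (Sum.inl i) (Sum.inl j)
        = 0 ∧
    fromBlocks (p • (1 : Matrix n n R)) (-(b' • diagonal δ')) (c • diagonal δ) (-(p • 1)) (Sum.inl i) (Sum.inr j)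
        = 0 ∧
    fromBlocks (p • (1 : Matrix n n R)) (-(b' • diagonal δ')) (c • diagonal δ) (-(p • 1)) (Sum.inr i) (Sum.inl j)
        = 0 ∧
    fromBlocks (p • (1 : Matrix n n R)) (-(b' • diagonal δ')) (c • diagonal δ) (-(p • 1)) (Sum.inr i) (Sum.inr j)
        = 0 := by
  simp [one_apply_ne hij, diagonal_apply_ne _ hij]

omit [Fintype n] in
/-- The `Γ_i`-block of `X₁` is the `2 × 2` matrix `(p −b'δ'ᵢ; cδᵢ −p)` — the complex structure of
`E_i = (Γ_{iℝ}/Γ_i, I_ω)` (with `p = ab⁻¹`, `c = b + a²b⁻¹`: the elliptic curve with `ω = τδᵢ`)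
[cite: GolyshevLuntsOrlov2001MirrorAV, proof of Prop. 9.6.1 (arXiv v2 p. 30 L8–L10)]. PROVED HERE. -/
theorem restr1_submatrix (δ δ' : n → R) (p b' c : R) (i : n) :
    (fromBlocks (p • (1 : Matrix n n R)) (-(b' • diagonal δ')) (c • diagonal δ) (-(p • 1))).submatrix
        ![Sum.inl i, Sum.inr i] ![Sum.inl i, Sum.inr i] = !![p, -(b' * δ' i); c * δ i, -p] := by
  ext a b
  fin_cases a <;> fin_cases b <;> simp [fromBlocks_apply₁₁, fromBlocks_apply₁₂, fromBlocks_apply₂₁,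
    fromBlocks_apply₂₂]

/-- **«For each `i` the map `Γ₁ → Γ_i`, `e₁ ↦ e_i`, `e*₋₁ ↦ δ₁⁻¹δ_i e*₋ᵢ` commutes with `I_{ω_A}` and so is an isogeny
of elliptic curves `E₁` and `E_i`»**: with `δᵢ = d δ₁` (`δ₁ | δᵢ`), `δ₁δ'₁ = 1 = δᵢδ'ᵢ`, the matrix `diag(1, d)` of that
map intertwines the two `Γ`-blocks [cite: GolyshevLuntsOrlov2001MirrorAV, proof of Prop. 9.6.1 (arXiv v2 p. 30
L11–L19)]. PROVED HERE. -/
theorem isogeny_commutes {δ₁ δ₁' δᵢ δᵢ' d : R} (hd : δᵢ = d * δ₁) (h₁ : δ₁ * δ₁' = 1) (hᵢ : δᵢ * δᵢ' = 1)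
    (p b' c : R) :
    !![(1 : R), 0; 0, d] * !![p, -(b' * δ₁'); c * δ₁, -p] = !![p, -(b' * δᵢ'); c * δᵢ, -p] * !![1, 0; 0, d] := by
  have hδ : δ₁' = δᵢ' * d := by
    calc δ₁' = δᵢ * δᵢ' * δ₁' := by rw [hᵢ, one_mul]
      _ = δᵢ' * d * (δ₁ * δ₁') := by rw [hd]; ring
      _ = δᵢ' * d := by rw [h₁, mul_one]
  ext a b
  fin_cases a <;> fin_cases b <;> simp [Matrix.mul_apply, Fin.sum_univ_two, hd, hδ] <;> ring

end Prop961

section Examples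

/-- Non-vacuity over `ℤ`, `n = Fin 1`, principal type `Δ = 1 = Δ'`, `τ = 1 + i` (`a = b = b' = 1`, `p = 1`,
`c = 2`): `φ = (0 −1; 1 0)`, `I = (1 −φ⁻¹; 2φ −1)`; `I² = −1`, `Iᵀ Q I = Q`, `Sᵀ I S = diag(X₁, X₂)` with
`X₁ = (1 −1; 2 −1)`, `X₂ = (−1 −2; 1 1) = −X₁ᵀ`, and `diag(X₁, X₂)` is itself `Q`-orthogonal with square `−1`.
Checked by `decide`. -/
theorem example_integral :
    let φ : Matrix (Fin 1 ⊕ Fin 1) (Fin 1 ⊕ Fin 1) ℤ := fromBlocks 0 (-1) 1 0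
    let φ' : Matrix (Fin 1 ⊕ Fin 1) (Fin 1 ⊕ Fin 1) ℤ := fromBlocks 0 1 (-1) 0
    let I : Matrix ((Fin 1 ⊕ Fin 1) ⊕ (Fin 1 ⊕ Fin 1)) ((Fin 1 ⊕ Fin 1) ⊕ (Fin 1 ⊕ Fin 1)) ℤ :=
      fromBlocks ((1 : ℤ) • 1) (-((1 : ℤ) • φ')) ((2 : ℤ) • φ) (-((1 : ℤ) • 1))
    let S : Matrix ((Fin 1 ⊕ Fin 1) ⊕ (Fin 1 ⊕ Fin 1)) ((Fin 1 ⊕ Fin 1) ⊕ (Fin 1 ⊕ Fin 1)) ℤ :=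
      fromBlocks (fromBlocks 1 0 0 0) (fromBlocks 0 0 0 1) (fromBlocks 0 0 0 1) (fromBlocks 1 0 0 0)
    let Q : Matrix ((Fin 1 ⊕ Fin 1) ⊕ (Fin 1 ⊕ Fin 1)) ((Fin 1 ⊕ Fin 1) ⊕ (Fin 1 ⊕ Fin 1)) ℤ := fromBlocks 0 1 1 0
    let X₁ : Matrix (Fin 1 ⊕ Fin 1) (Fin 1 ⊕ Fin 1) ℤ := fromBlocks 1 (-1) 2 (-1)
    let X₂ : Matrix (Fin 1 ⊕ Fin 1) (Fin 1 ⊕ Fin 1) ℤ := fromBlocks (-1) (-2) 1 1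
    φ * φ' = 1 ∧ I * I = -1 ∧ Iᵀ * Q * I = Q ∧ Sᵀ * I * S = fromBlocks X₁ 0 0 X₂ ∧ X₂ = -X₁ᵀ ∧
      (fromBlocks X₁ 0 0 X₂)ᵀ * Q * fromBlocks X₁ 0 0 X₂ = Q ∧
      fromBlocks X₁ 0 0 X₂ * fromBlocks X₁ 0 0 X₂ = -1 ∧ I ≠ fromBlocks X₁ 0 0 X₂ := by
  refine ⟨?_, ?_, ?_, ?_, ?_, ?_, ?_, ?_⟩ <;> decide

/-- Non-vacuity of the isogeny statement off the principal type, over the field `ZMod 5` (so that `δ₂ = 2` is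
invertible): `δ = (1, 2)`, `δ' = (1, 3)`, `d = 2`, `p = 1`, `b' = 1`, `c = 2`:
`diag(1, 2)·(1 −1; 2 −1) = (1 −3; 4 −1)·diag(1, 2)`. Checked by `decide`. -/
theorem example_mod5 :
    (2 : ZMod 5) = 2 * 1 ∧ (1 : ZMod 5) * 1 = 1 ∧ (2 : ZMod 5) * 3 = 1 ∧
    !![(1 : ZMod 5), 0; 0, 2] * !![1, -(1 * 1); 2 * 1, -1] = !![1, -(1 * 3); 2 * 2, -1] * !![1, 0; 0, 2] := by
  refine ⟨?_, ?_, ?_, ?_⟩ <;> decide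

end Examples

end Summit.Ventures.HSemireg.GolyshevLuntsOrlovMirror
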